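import Summits.QuantumFields.YangMills.Theorems.BalabanUVNodesN21HistoriesResamplingTower
import Summits.QuantumFields.YangMills.Theorems.BalabanUVNodesN21HybridResamplingLift

/-!
# N21 (NE7c) — module 38b «LIFTED STAGE LAWS»: one ℝ-stage on ONE product history space — the lifted term density (receivers kept, sent terms
# hybrid-lifted: 38a, lens Card 56), the stage laws «density × forward kernel», and the four faces module 20n consumes per run — (Mass),
# (N)∕(Eoff) as EQUALITIES of image laws, (Eon) per sender, and 20n's `hon` sum shape over one receiver from the printed quotients' CHARGE

Seat `pub-ymgap-dag-n21-e` (g12), own hand; lane `--kind definition --supports stmt-QuantumFields-20544 --as helper` (K3⁷ `SpineGivenEndpointR13SepCoPH`).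
Count-neutral.  Consumer: 38c `…N21HistoriesHybridLiftTower` (20n `shellWeightBound_histories_of_resamplingTower` BY NAME, stage-law binders discharged).

THE DICTIONARY (lens `LENS-nearmiss.md` v20.0 Card 56, typed here).  At one stage, on the product space `Π i, X i` with product probability reference
law `Measure.pi μ`: terms `s : ι`, print's selector `sel` (a RECEIVER is a `sel`-fixed term — no exhausted component at this step; a SENT term has
`sel s ≠ s`), older coordinates `O`, fibres `F s`, younger coordinates `Y` carried by a forward kernel `Φ` of fibrewise mass one
(`∫⋯∫⁻_Y Φ = 1`) read by no truncated density, and per sent term an INSERT `ins s` (lens v21.0 ROW P′: a PARAMETER — `ins s := d (sel s)` is the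
(0.3)-literal receiver-law insert of record, print's ℝ inserts the background-centred WINDOW law (1.100)–(1.101)).  `liftDensity μ O F sel ins d s :=
if sel s = s then d s else hybridLift μ O (F s) (ins s) (d s)`; `preLaw μ Φ d s := pi.withDensity (d s · Φ)` (20n's `Jpre`), `postLaw μ O F sel Φ ins d s
:= pi.withDensity (liftDensity s · Φ)` (20n's `J`), `insLaw μ Φ ins s := pi.withDensity (ins s · Φ)`.
WHAT IS PROVED ([folklore]; 38a's (L1′)∕(L3)∕(L4)∕(L5) with the forward kernel integrated out first and re-inserted).  §1 independence transport
(`indepOf_lmarginal_of_disjoint`, `indepOf_hybridLift` — 38a (L5)'s `hLY` input discharged; `notRead_of_dependsOn` — the read-set form of `NotRead`).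
§2 the one-level dictionary (`hybridLift_empty`, `rop03_eq_sum_hybridLift`: with `O = ∅` the lift IS b01's (0.3) summand and `Rop03` the sum of the
one-level lifts); 38a's (L1)∕(L1′)∕(L4)∕(L5) under the SUPPORT proviso «denominator `= 0 ⇒` sender's fibre integral `= 0`; `≠ ∞`» instead of b01's
`≠ 0` (the form indicator-carrying receivers of record need; lens KT-56b, n21-e 20 §4); the stage laws and their faces — `postLaw_univ_eq` (Mass), ★
`map_postLaw_eq_of_notRead` ((N)∕(Eoff) as EQUALITY of image laws: 20n's `hN`∕`hoff`), ★ `map_postLaw_le_insLaw_of_sent` ∕ `map_postLaw_le_of_sent`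
((Eon) per sender: `≤ q •` the insert's law, `≤ (q·B) •` the receiver's under the nesting `ins s ≤ B·d (sel s)` — HONEST: a finite exterior-uniform `q`
is print's for the WINDOW insert, [LF-II] p. 358; for the receiver-law insert on sharp-threshold terms no finite `q` exists, lens v21.0 Card 61), ★★
`sum_map_postLaw_le` (20n's `hon` over one receiver from the CHARGE `Σ_{s ON, sel s = s′} q s·B s ≤ δ`, ON ⊆ sent, receivers `sel`-fixed).  The
density-level forms of 20n's (P) ∕ older-causality and the charge from a component count are in 38c.

HONEST FRAMING.  [textbook] measure theory (`withDensity`, `Measure.map`, Mathlib `lmarginal`) + [folklore] bookkeeping; 4 defs (`liftDensity`,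
`preLaw`, `postLaw`, `insLaw`), 0 sorry; NOTHING of Bałaban's is asserted (context only: [Balaban1989LargeFieldI] (0.3)–(0.4) p. 176); the printed quotient
bound `q`, the nesting `B` and their charge are DISPLAYED (NODE O's numbers, K2⁷-facing; bounded uniformly in `K` suffices, lens ROW Q″); the
insert's denominators carry the SUPPORT proviso; NE7c ((M1) at the live slots) is NOT
PRINTED and NOT PROVED; N21 NOT discharged; count-neutral; one finite 𝕋⁴ at fixed ε — nothing about ℝ⁴ ∕ OS ∕ mass gap ∕ Clay.

CITATION HEADER (lean-in-tree rule).  BY NAME: 38a `N21HybridResamplingLift.hybridLift` ∕ `NotRead` ∕ `measurable_hybridLift` ∕ `lintegral_hybridLift` ∕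
`lintegral_hybridLift_mul_le` ∕ `lintegral_hybridLift_fwd_mul_of_indepOf` ∕ `lintegral_mul_fwd_eq` ∕ `indepOf_indicator_preimage` ∕
`setLIntegral_eq_lintegral_mul_indicator` (lens g20, credited there); b01 `B15.BasicStep.IndepOf` ∕ `Rop03`; `T4LimitDensity.smul_le_smul_measure`;
`T4JointDressing.updateFinset_updateFinset_comm`.
-/

set_option autoImplicit false

open MeasureTheory Set Function
open scoped BigOperators ENNReal
open Literature.MathematicalPhysics.QuantumFieldTheory.Balaban1983to89.B15.BasicStep

namespace Summit.QuantumFields.YangMills.Theorems.N21HistoriesLiftedStageLaws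

open Summit.QuantumFields.YangMills.Theorems.N21HybridResamplingLift
open Literature.MathematicalPhysics.QuantumFieldTheory.Balaban1983to89 (T4JointDressing.updateFinset_updateFinset_comm)
open Literature.MathematicalPhysics.QuantumFieldTheory.Balaban1983to89.T4LimitDensity (smul_le_smul_measure)

/-! ## §1 Independence transport: a function not reading `Y` keeps that property under fibre integrals over sets disjoint from `Y`,
and so does the hybrid lift -/

section Indep

variable {β : Type*} [DecidableEq β] {X : β → Type*} [∀ i, MeasurableSpace (X i)]
  {μ : ∀ i, Measure (X i)}

/-- a `Y`-independent integrand has a `Y`-independent fibre integral over any coordinate set disjoint from `Y` (the two coordinate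
updates commute, `T4JointDressing.updateFinset_updateFinset_comm`). [folklore] -/
theorem indepOf_lmarginal_of_disjoint {Y S : Finset β} (hYS : Disjoint Y S) {f : (∀ i, X i) → ℝ≥0∞} (hf : IndepOf Y f) :
    IndepOf Y (∫⋯∫⁻_S, f ∂μ) := by
  intro x y
  simp only [lmarginal]
  refine lintegral_congr fun z => ?_
  rw [T4JointDressing.updateFinset_updateFinset_comm hYS, hf]

omit [∀ i, MeasurableSpace (X i)] in
/-- the product of two `Y`-independent functions is `Y`-independent. [folklore] -/
theorem indepOf_mul_fun {Y : Finset β} {f g : (∀ i, X i) → ℝ≥0∞} (hf : IndepOf Y f) (hg : IndepOf Y g) :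
    IndepOf Y (fun V => f V * g V) := fun x y => by simp only [hf x y, hg x y]

/-- the hybrid lift of `Y`-independent densities over coordinate sets `O`, `F` disjoint from `Y` is `Y`-independent (the `hLY` input of
38a's (L5) `lintegral_hybridLift_fwd_mul_of_indepOf`, discharged). [folklore] -/
theorem indepOf_hybridLift {Y O F : Finset β} (hYO : Disjoint Y O) (hYF : Disjoint Y F) {b a : (∀ i, X i) → ℝ≥0∞}
    (hb : IndepOf Y b) (ha : IndepOf Y a) : IndepOf Y (hybridLift μ O F b a) := by
  intro x y
  simp only [hybridLift, indepOf_lmarginal_of_disjoint hYO hb x y, indepOf_lmarginal_of_disjoint hYF ha x y,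
    indepOf_lmarginal_of_disjoint hYF (indepOf_lmarginal_of_disjoint (μ := μ) hYO hb) x y]


omit [∀ i, MeasurableSpace (X i)] in
/-- **THE READ-SET FORM OF `NotRead`**: a statistic depending only on the coordinates in `S` reads no coordinate set disjoint from `S` (at the
record: `S` = the bonds of the read collar `□_c^{≈7}` of the slot's cube, n21-e 31∕33; the four `NotRead` binders of 38c become disjointness of read
sets from fibres ∕ older ∕ younger coordinates). [folklore] -/
theorem notRead_of_dependsOn {S F : Finset β} {u : (∀ i, X i) → ℝ} (hu : DependsOn u (S : Set β)) (hSF : Disjoint S F) :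
    NotRead F u := by
  intro V y
  refine hu fun i hi => ?_
  have hiF : i ∉ F := Finset.disjoint_left.1 hSF (Finset.mem_coe.1 hi)
  simp only [updateFinset, dif_neg hiF]

end Indep

/-! ## §2 ONE STAGE ON ONE PRODUCT SPACE: the lifted term density, the stage laws «density × forward kernel», and the four faces
20n consumes — mass, (N)∕(Eoff) as equalities of image laws, (Eon) per sender, and the `hon` sum shape over one receiver -/

section OneStage

variable {β : Type*} [Fintype β] [DecidableEq β] {X : β → Type*} [∀ i, MeasurableSpace (X i)]
  {μ : ∀ i, Measure (X i)} [∀ i, IsProbabilityMeasure (μ i)] {ι : Type*} [DecidableEq ι]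

/-! ### Dictionary to b01 at ONE level: with no older coordinates the lift IS print's (0.3) summand -/

omit [Fintype β] [∀ i, IsProbabilityMeasure (μ i)] in
/-- **AT ONE LEVEL** (`O = ∅`: def-R's single-level density model, «older levels integrated inside `TexpA`») the hybrid lift IS b01's (0.3) summand
`ρ(Z″,V)·∫dV⌈_{Z′}ρ(Z,V) ∕ ∫dV⌈_{Z′}ρ(Z″,V)` — receiver density times the printed quotient. [cite: Balaban1989LargeFieldI, (0.3) p.176] -/
theorem hybridLift_empty (F : Finset β) (b a : (∀ i, X i) → ℝ≥0∞) :
    hybridLift μ ∅ F b a = fun V => b V * ((∫⋯∫⁻_F, a ∂μ) V / (∫⋯∫⁻_F, b ∂μ) V) := by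
  ext V; simp only [hybridLift, lmarginal_empty]

omit [Fintype β] [∀ i, IsProbabilityMeasure (μ i)] in
/-- … hence b01's CONCRETE (0.3) `Rop03 μ piece pp fib` is the sum over the terms of their one-level lifts (sender `piece Z`, receiver
`piece (pp Z)`, fibre `fib Z`). [cite: Balaban1989LargeFieldI, (0.3) p.176] -/
theorem rop03_eq_sum_hybridLift {R : Type*} [Fintype R] (piece : R → (∀ i, X i) → ℝ≥0∞) (pp : R → R) (fib : R → Finset β) :
    Rop03 μ piece pp fib = fun V => ∑ Z, hybridLift μ ∅ (fib Z) (piece (pp Z)) (piece Z) V := by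
  ext V; simp only [Rop03, hybridLift_empty]

/-! ### 38a's (L1)∕(L1′)∕(L4)∕(L5) under the SUPPORT PROVISO instead of `h0` (lens KT-56b: at indicator-carrying receivers of record the
denominator `∫⋯∫⁻_F ρ_b` vanishes wherever an outer small-field indicator of the receiver fails — there the sender's fibre integral vanishes too;
n21-e 20 §4's `_of_le` cure in `lmarginal` currency) -/

omit [Fintype β] in
/-- **(L1) under the support proviso**: the `F`-integral of the lift is the sender's as soon as the sender's fibre integral VANISHES WHEREVER
the receiver's denominator does (`hsupp`) and the denominator is finite — no non-vanishing needed (`x∕0 · 0 = 0`). [folklore] -/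
theorem lmarginal_fibre_hybridLift_of_support (O F : Finset β) {b a : (∀ i, X i) → ℝ≥0∞} (hb : Measurable b)
    (hsupp : ∀ V, (∫⋯∫⁻_F, (∫⋯∫⁻_O, b ∂μ) ∂μ) V = 0 → (∫⋯∫⁻_F, a ∂μ) V = 0)
    (htop : ∀ V, (∫⋯∫⁻_F, (∫⋯∫⁻_O, b ∂μ) ∂μ) V ≠ ∞) :
    ∫⋯∫⁻_F, hybridLift μ O F b a ∂μ = ∫⋯∫⁻_F, a ∂μ := by
  have hratio : IndepOf F (fun V => (∫⋯∫⁻_F, a ∂μ) V / (∫⋯∫⁻_F, (∫⋯∫⁻_O, b ∂μ) ∂μ) V) := fun x y => by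
    simp only [indepOf_lmarginal μ F a x y, indepOf_lmarginal μ F (∫⋯∫⁻_O, b ∂μ) x y]
  have e : hybridLift μ O F b a = (fun V => (∫⋯∫⁻_F, a ∂μ) V / (∫⋯∫⁻_F, (∫⋯∫⁻_O, b ∂μ) ∂μ) V) * (∫⋯∫⁻_O, b ∂μ) := by
    ext V; simp only [hybridLift, Pi.mul_apply, mul_comm]
  rw [e, lmarginal_mul_of_indepOf F hratio (hb.lmarginal μ)]
  ext V
  simp only [Pi.mul_apply]
  by_cases h0 : (∫⋯∫⁻_F, (∫⋯∫⁻_O, b ∂μ) ∂μ) V = 0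
  · rw [h0, mul_zero, hsupp V h0]
  · exact ENNReal.div_mul_cancel h0 (htop V)

/-- **(L1′) = (N) under the support proviso**: against a weight not reading the fibre the lift integrates like the sender. [folklore] -/
theorem lintegral_hybridLift_mul_of_indepOf_of_support (O F : Finset β) {b a w : (∀ i, X i) → ℝ≥0∞}
    (hb : Measurable b) (ha : Measurable a) (hw : Measurable w) (hwF : IndepOf F w)
    (hsupp : ∀ V, (∫⋯∫⁻_F, (∫⋯∫⁻_O, b ∂μ) ∂μ) V = 0 → (∫⋯∫⁻_F, a ∂μ) V = 0)
    (htop : ∀ V, (∫⋯∫⁻_F, (∫⋯∫⁻_O, b ∂μ) ∂μ) V ≠ ∞) :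
    ∫⁻ V, hybridLift μ O F b a V * w V ∂Measure.pi μ = ∫⁻ V, a V * w V ∂Measure.pi μ := by
  have hL := measurable_hybridLift (μ := μ) O F hb ha
  refine lintegral_eq_of_lmarginal_eq F (hL.mul hw) (ha.mul hw) ?_
  have e1 : (fun V => hybridLift μ O F b a V * w V) = w * hybridLift μ O F b a := by ext V; simp [mul_comm]
  have e2 : (fun V => a V * w V) = w * a := by ext V; simp [mul_comm]
  rw [e1, e2, lmarginal_mul_of_indepOf F hwF hL, lmarginal_mul_of_indepOf F hwF ha, lmarginal_fibre_hybridLift_of_support O F hb hsupp htop]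

/-- **(L4) under the support proviso**: the lift has the sender's mass. [folklore] -/
theorem lintegral_hybridLift_of_support (O F : Finset β) {b a : (∀ i, X i) → ℝ≥0∞} (hb : Measurable b) (ha : Measurable a)
    (hsupp : ∀ V, (∫⋯∫⁻_F, (∫⋯∫⁻_O, b ∂μ) ∂μ) V = 0 → (∫⋯∫⁻_F, a ∂μ) V = 0)
    (htop : ∀ V, (∫⋯∫⁻_F, (∫⋯∫⁻_O, b ∂μ) ∂μ) V ≠ ∞) :
    ∫⁻ V, hybridLift μ O F b a V ∂Measure.pi μ = ∫⁻ V, a V ∂Measure.pi μ := by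
  simpa using lintegral_hybridLift_mul_of_indepOf_of_support O F hb ha measurable_const (w := fun _ => 1) (fun _ _ => rfl) hsupp htop

/-- **(L5)+(N) under the support proviso** on the full history space: lift `· Φ`, sender `· Φ`, weight reading neither the fibre nor the younger
coordinates. [folklore] -/
theorem lintegral_hybridLift_fwd_mul_of_indepOf_of_support (O F Y : Finset β) {b a Φ w : (∀ i, X i) → ℝ≥0∞}
    (hb : Measurable b) (ha : Measurable a) (hΦ : Measurable Φ) (hw : Measurable w)
    (haY : IndepOf Y a) (hLY : IndepOf Y (hybridLift μ O F b a)) (hwF : IndepOf F w) (hwY : IndepOf Y w)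
    (hΦ1 : ∫⋯∫⁻_Y, Φ ∂μ = fun _ => 1)
    (hsupp : ∀ V, (∫⋯∫⁻_F, (∫⋯∫⁻_O, b ∂μ) ∂μ) V = 0 → (∫⋯∫⁻_F, a ∂μ) V = 0)
    (htop : ∀ V, (∫⋯∫⁻_F, (∫⋯∫⁻_O, b ∂μ) ∂μ) V ≠ ∞) :
    ∫⁻ V, hybridLift μ O F b a V * Φ V * w V ∂Measure.pi μ = ∫⁻ V, a V * Φ V * w V ∂Measure.pi μ := by
  have hL := measurable_hybridLift (μ := μ) O F hb ha
  have e1 : ∀ g : (∀ i, X i) → ℝ≥0∞, (fun V => g V * Φ V * w V) = fun V => (g V * w V) * Φ V := fun g => by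
    ext V; ring
  rw [e1, e1, lintegral_mul_fwd_eq Y (f := fun V => hybridLift μ O F b a V * w V) (hL.mul hw) hΦ
      (fun x y => by simp only [hLY x y, hwY x y]) hΦ1,
    lintegral_mul_fwd_eq Y (f := fun V => a V * w V) (ha.mul hw) hΦ (fun x y => by simp only [haY x y, hwY x y]) hΦ1]
  exact lintegral_hybridLift_mul_of_indepOf_of_support O F hb ha hw hwF hsupp htop

variable (μ) in
/-- **THE LIFTED TERM DENSITY OF ONE STAGE** (lens Card 56's dictionary, with the INSERT a parameter — lens v21.0 ROW P′): a term `s` fixed by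
print's selector (`sel s = s`: a RECEIVER, no exhausted component at this step) keeps its density; a SENT term (`sel s ≠ s`) gets the hybrid
resampling lift of its density `d s` against the INSERT `ins s` over the older coordinates `O` and its fibre `F s` — densities TRUNCATED at the
stage's level (the younger levels ride on the forward kernel `Φ`, appended by `preLaw`∕`postLaw`).  `ins s := d (sel s)` is the (0.3)-literal
receiver-law insert of record (def-R `rratio`, b01 `normTerm`); print's ℝ inserts the background-centred WINDOW law ((1.100)–(1.101) [IV];
[LF-II] p. 358) — the identities below are INSERT-BLIND, only the (Eon) domination reads the insert. [folklore] -/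
noncomputable def liftDensity (O : Finset β) (F : ι → Finset β) (sel : ι → ι) (ins d : ι → (∀ i, X i) → ℝ≥0∞) (s : ι) :
    (∀ i, X i) → ℝ≥0∞ :=
  if sel s = s then d s else hybridLift μ O (F s) (ins s) (d s)

omit [Fintype β] [∀ i, IsProbabilityMeasure (μ i)] in
/-- a receiver keeps its density. [folklore] -/
theorem liftDensity_of_eq {O : Finset β} {F : ι → Finset β} {sel : ι → ι} {ins d : ι → (∀ i, X i) → ℝ≥0∞} {s : ι}
    (h : sel s = s) : liftDensity μ O F sel ins d s = d s := if_pos h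

omit [Fintype β] [∀ i, IsProbabilityMeasure (μ i)] in
/-- a sent term is lifted against its insert. [folklore] -/
theorem liftDensity_of_ne {O : Finset β} {F : ι → Finset β} {sel : ι → ι} {ins d : ι → (∀ i, X i) → ℝ≥0∞} {s : ι}
    (h : sel s ≠ s) : liftDensity μ O F sel ins d s = hybridLift μ O (F s) (ins s) (d s) := if_neg h

omit [Fintype β] in
/-- measurability of the lifted density. [textbook] -/
theorem measurable_liftDensity (O : Finset β) (F : ι → Finset β) (sel : ι → ι) {ins d : ι → (∀ i, X i) → ℝ≥0∞}
    (hins : ∀ s, Measurable (ins s)) (hd : ∀ s, Measurable (d s)) (s : ι) : Measurable (liftDensity μ O F sel ins d s) := by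
  by_cases h : sel s = s
  · rw [liftDensity_of_eq h]; exact hd s
  · rw [liftDensity_of_ne h]; exact measurable_hybridLift O (F s) (hins _) (hd _)

omit [Fintype β] [∀ i, IsProbabilityMeasure (μ i)] in
/-- the lifted density does not read the younger coordinates when the truncated densities and inserts do not and `O`, `F s` avoid them. [folklore] -/
theorem indepOf_liftDensity {Y O : Finset β} {F : ι → Finset β} {sel : ι → ι} {ins d : ι → (∀ i, X i) → ℝ≥0∞} {s : ι}
    (hYO : Disjoint Y O) (hYF : Disjoint Y (F s)) (hins : ∀ s, IndepOf Y (ins s)) (hd : ∀ s, IndepOf Y (d s)) :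
    IndepOf Y (liftDensity μ O F sel ins d s) := by
  by_cases h : sel s = s
  · rw [liftDensity_of_eq h]; exact hd s
  · rw [liftDensity_of_ne h]; exact indepOf_hybridLift hYO hYF (hins _) (hd _)

variable (μ) in
/-- **THE PRE-ℝ STAGE LAW** of term `s`: product reference law with density «truncated term density × forward kernel `Φ`». [folklore] -/
noncomputable def preLaw (Φ : (∀ i, X i) → ℝ≥0∞) (d : ι → (∀ i, X i) → ℝ≥0∞) (s : ι) : Measure (∀ i, X i) :=
  (Measure.pi μ).withDensity fun V => d s V * Φ V

variable (μ) in
/-- **THE POST-ℝ STAGE LAW** of term `s`: «lifted density × forward kernel `Φ`» (lens Card 56: `JA k s := (pi Haar).withDensity (hybridLift … · Φ)`). [folklore] -/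
noncomputable def postLaw (O : Finset β) (F : ι → Finset β) (sel : ι → ι) (Φ : (∀ i, X i) → ℝ≥0∞)
    (ins d : ι → (∀ i, X i) → ℝ≥0∞) (s : ι) : Measure (∀ i, X i) :=
  (Measure.pi μ).withDensity fun V => liftDensity μ O F sel ins d s V * Φ V

variable (μ) in
/-- the INSERT's own stage law «insert × forward kernel» — the comparison law of the (Eon) domination. [folklore] -/
noncomputable def insLaw (Φ : (∀ i, X i) → ℝ≥0∞) (ins : ι → (∀ i, X i) → ℝ≥0∞) (s : ι) : Measure (∀ i, X i) :=
  (Measure.pi μ).withDensity fun V => ins s V * Φ V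

omit [DecidableEq β] [∀ i, IsProbabilityMeasure (μ i)] in
/-- total mass of a `withDensity` law over the product reference law. [textbook] -/
theorem pi_withDensity_univ (g : (∀ i, X i) → ℝ≥0∞) : (Measure.pi μ).withDensity g univ = ∫⁻ V, g V ∂Measure.pi μ := by
  rw [withDensity_apply _ MeasurableSet.univ, Measure.restrict_univ]

omit [DecidableEq β] [∀ i, IsProbabilityMeasure (μ i)] in
/-- image-law mass of a set `A` under a `withDensity` law = the integral of «density × indicator weight». [textbook] -/
theorem map_withDensity_apply_eq (g : (∀ i, X i) → ℝ≥0∞) {u : (∀ i, X i) → ℝ} (hu : Measurable u) {A : Set ℝ}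
    (hA : MeasurableSet A) :
    ((Measure.pi μ).withDensity g).map u A = ∫⁻ V, g V * (u ⁻¹' A).indicator 1 V ∂Measure.pi μ := by
  rw [Measure.map_apply hu hA, withDensity_apply _ (hu hA), setLIntegral_eq_lintegral_mul_indicator _ g (hu hA)]

variable {O Y : Finset β} {F : ι → Finset β} {sel : ι → ι} {Φ : (∀ i, X i) → ℝ≥0∞} {ins d : ι → (∀ i, X i) → ℝ≥0∞}

/-- **(Mass) per term**: the post-ℝ stage law has the pre-ℝ mass — (L4) for a sent term after the forward kernel is integrated out first
((L5), `lintegral_mul_fwd_eq`), trivially for a receiver; the insert's denominator under the SUPPORT proviso (`= 0 ⇒` the sender's fibre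
integral `= 0`; `≠ ∞`). [folklore] -/
theorem postLaw_univ_eq (hins : ∀ s, Measurable (ins s)) (hd : ∀ s, Measurable (d s)) (hΦ : Measurable Φ) (hYO : Disjoint Y O)
    (hYF : ∀ s, Disjoint Y (F s)) (hinsY : ∀ s, IndepOf Y (ins s)) (hdY : ∀ s, IndepOf Y (d s)) (hΦ1 : ∫⋯∫⁻_Y, Φ ∂μ = fun _ => 1) (s : ι)
    (hden : sel s ≠ s → ∀ V, ((∫⋯∫⁻_(F s), (∫⋯∫⁻_O, ins s ∂μ) ∂μ) V = 0 → (∫⋯∫⁻_(F s), d s ∂μ) V = 0) ∧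
      (∫⋯∫⁻_(F s), (∫⋯∫⁻_O, ins s ∂μ) ∂μ) V ≠ ∞) :
    postLaw μ O F sel Φ ins d s univ = preLaw μ Φ d s univ := by
  rw [postLaw, preLaw, pi_withDensity_univ, pi_withDensity_univ]
  by_cases h : sel s = s
  · simp only [liftDensity_of_eq h]
  · simp only [liftDensity_of_ne h]
    rw [lintegral_mul_fwd_eq Y (measurable_hybridLift O (F s) (hins _) (hd _)) hΦ (indepOf_hybridLift hYO (hYF s) (hinsY _) (hdY _)) hΦ1,
      lintegral_mul_fwd_eq Y (hd s) hΦ (hdY s) hΦ1]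
    exact lintegral_hybridLift_of_support O (F s) (hins _) (hd _) (fun V => (hden h V).1) (fun V => (hden h V).2)

/-- **(N)∕(Eoff) per term AS 20n WANTS IT** (insert-blind): a statistic reading NEITHER the sender's fibre NOR the younger coordinates has the
same image law under the post-ℝ and the pre-ℝ stage laws of the term (receivers: trivially; sent terms: 38a (L1′)+(L5) under the support
proviso). [folklore] -/
theorem map_postLaw_eq_of_notRead (hins : ∀ s, Measurable (ins s)) (hd : ∀ s, Measurable (d s)) (hΦ : Measurable Φ) (hYO : Disjoint Y O)
    (hYF : ∀ s, Disjoint Y (F s)) (hinsY : ∀ s, IndepOf Y (ins s)) (hdY : ∀ s, IndepOf Y (d s)) (hΦ1 : ∫⋯∫⁻_Y, Φ ∂μ = fun _ => 1) (s : ι)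
    (hden : sel s ≠ s → ∀ V, ((∫⋯∫⁻_(F s), (∫⋯∫⁻_O, ins s ∂μ) ∂μ) V = 0 → (∫⋯∫⁻_(F s), d s ∂μ) V = 0) ∧
      (∫⋯∫⁻_(F s), (∫⋯∫⁻_O, ins s ∂μ) ∂μ) V ≠ ∞)
    {u : (∀ i, X i) → ℝ} (hu : Measurable u) (huF : sel s ≠ s → NotRead (F s) u) (huY : NotRead Y u) :
    (postLaw μ O F sel Φ ins d s).map u = (preLaw μ Φ d s).map u := by
  by_cases h : sel s = s
  · simp only [postLaw, preLaw, liftDensity_of_eq h]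
  ext A hA
  rw [postLaw, preLaw, map_withDensity_apply_eq _ hu hA, map_withDensity_apply_eq _ hu hA]
  simp only [liftDensity_of_ne h]
  exact lintegral_hybridLift_fwd_mul_of_indepOf_of_support O (F s) Y (hins _) (hd _) hΦ (measurable_const.indicator (hu hA)) (hdY s)
    (indepOf_hybridLift hYO (hYF s) (hinsY _) (hdY _)) (indepOf_indicator_preimage (huF h) A) (indepOf_indicator_preimage huY A)
    hΦ1 (fun V => (hden h V).1) (fun V => (hden h V).2)

/-- **(Eon) per sender, against the INSERT**: a CURRENT-LEVEL statistic (reading neither the older coordinates `O` nor the younger ones) has image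
law under a SENT term's post-ℝ stage law `≤ q •` its image law under the INSERT's stage law, `q` any pointwise bound of the PRINTED quotient
`∫_{O∪F} d s ≤ q · ∫_{O∪F} ins s` (38a (L3), forward kernel integrated out first and re-inserted).  HONEST: a finite exterior-uniform `q` is
print's for the WINDOW insert ([LF-II] p. 358, bounded below by `exp(−O(M⁴))`); for the receiver-law insert on sharp-threshold terms no finite
`q` exists (lens v21.0 Card 61, Sketch-g21 §T caricature). [folklore] -/
theorem map_postLaw_le_insLaw_of_sent (hins : ∀ s, Measurable (ins s)) (hd : ∀ s, Measurable (d s)) (hΦ : Measurable Φ) (hYO : Disjoint Y O)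
    (hYF : ∀ s, Disjoint Y (F s)) (hOF : ∀ s, Disjoint O (F s)) (hinsY : ∀ s, IndepOf Y (ins s)) (hdY : ∀ s, IndepOf Y (d s))
    (hΦ1 : ∫⋯∫⁻_Y, Φ ∂μ = fun _ => 1) {s : ι} (hs : sel s ≠ s)
    {q : ℝ≥0∞} (hq : ∀ V, (∫⋯∫⁻_(O ∪ F s), d s ∂μ) V ≤ q * (∫⋯∫⁻_(O ∪ F s), ins s ∂μ) V)
    {u : (∀ i, X i) → ℝ} (hu : Measurable u) (huO : NotRead O u) (huY : NotRead Y u) :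
    (postLaw μ O F sel Φ ins d s).map u ≤ q • (insLaw μ Φ ins s).map u := by
  rw [Measure.le_iff]
  intro A hA
  rw [Measure.smul_apply, smul_eq_mul, postLaw, insLaw, map_withDensity_apply_eq _ hu hA, map_withDensity_apply_eq _ hu hA]
  simp only [liftDensity_of_ne hs]
  have hw : Measurable ((u ⁻¹' A).indicator (1 : (∀ i, X i) → ℝ≥0∞)) := measurable_const.indicator (hu hA)
  have hwY : IndepOf Y ((u ⁻¹' A).indicator (1 : (∀ i, X i) → ℝ≥0∞)) := indepOf_indicator_preimage huY A
  have hL := measurable_hybridLift (μ := μ) O (F s) (hins s) (hd s)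
  have e1 : ∀ g : (∀ i, X i) → ℝ≥0∞, (fun V => g V * Φ V * (u ⁻¹' A).indicator 1 V) = fun V => (g V * (u ⁻¹' A).indicator 1 V) * Φ V :=
    fun g => by ext V; ring
  rw [e1, e1, lintegral_mul_fwd_eq Y (f := fun V => hybridLift μ O (F s) (ins s) (d s) V * (u ⁻¹' A).indicator 1 V)
      (hL.mul hw) hΦ (indepOf_mul_fun (indepOf_hybridLift hYO (hYF s) (hinsY _) (hdY _)) hwY) hΦ1,
    lintegral_mul_fwd_eq Y (f := fun V => ins s V * (u ⁻¹' A).indicator 1 V) ((hins _).mul hw) hΦ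
      (indepOf_mul_fun (hinsY _) hwY) hΦ1]
  exact lintegral_hybridLift_mul_le (hOF s) (hins _) (hd _) hw (indepOf_indicator_preimage huO A) hq

omit [DecidableEq β] [∀ i, IsProbabilityMeasure (μ i)] [DecidableEq ι] in
/-- the insert's stage law is dominated by `B •` the receiver's pre-ℝ stage law when the insert is pointwise `≤ B ·` the receiver's density
(print: the window law is NESTED in the receiver's small-field law, (1.89) p. 198 ∕ (1.70) [LF-II], up to the Wilson-term comparison `B`, which may
be LARGE — lens Sketch-g21 §N `windowLift_le_smul_receiver`). [folklore] -/
theorem insLaw_le_smul_preLaw (hd : ∀ s, Measurable (d s)) (hΦ : Measurable Φ) {s r : ι} {B : ℝ≥0∞}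
    (hdom : ∀ V, ins s V ≤ B * d r V) : insLaw μ Φ ins s ≤ B • preLaw μ Φ d r := by
  rw [insLaw, preLaw, ← withDensity_smul (f := fun V => d r V * Φ V) B ((hd r).mul hΦ)]
  refine withDensity_mono (Filter.Eventually.of_forall fun V => ?_)
  show ins s V * Φ V ≤ B * (d r V * Φ V)
  rw [← mul_assoc]
  exact mul_le_mul' (hdom V) le_rfl

/-- **(Eon) per sender AS 20n WANTS IT** (against the RECEIVER): quotient bound `q` against the insert and nesting `ins s ≤ B · d (sel s)` give
`≤ (q·B) •` the receiver's pre-ℝ image law. [folklore] -/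
theorem map_postLaw_le_of_sent (hins : ∀ s, Measurable (ins s)) (hd : ∀ s, Measurable (d s)) (hΦ : Measurable Φ) (hYO : Disjoint Y O)
    (hYF : ∀ s, Disjoint Y (F s)) (hOF : ∀ s, Disjoint O (F s)) (hinsY : ∀ s, IndepOf Y (ins s)) (hdY : ∀ s, IndepOf Y (d s))
    (hΦ1 : ∫⋯∫⁻_Y, Φ ∂μ = fun _ => 1) {s : ι} (hs : sel s ≠ s)
    {q B : ℝ≥0∞} (hq : ∀ V, (∫⋯∫⁻_(O ∪ F s), d s ∂μ) V ≤ q * (∫⋯∫⁻_(O ∪ F s), ins s ∂μ) V) (hdom : ∀ V, ins s V ≤ B * d (sel s) V)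
    {u : (∀ i, X i) → ℝ} (hu : Measurable u) (huO : NotRead O u) (huY : NotRead Y u) :
    (postLaw μ O F sel Φ ins d s).map u ≤ (q * B) • (preLaw μ Φ d (sel s)).map u := by
  refine (map_postLaw_le_insLaw_of_sent hins hd hΦ hYO hYF hOF hinsY hdY hΦ1 hs hq hu huO huY).trans ?_
  have h2 : (insLaw μ Φ ins s).map u ≤ B • (preLaw μ Φ d (sel s)).map u := by
    rw [← Measure.map_smul]; exact Measure.map_mono (insLaw_le_smul_preLaw hd hΦ hdom) hu
  rw [mul_smul]; exact smul_le_smul_measure le_rfl h2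

/-- **THE `hon` SHAPE OF 20n OVER ONE RECEIVER** `s′`: the ON senders with receiver `s′` — all of them SENT (`sel s ≠ s`), the receiver a
`sel`-fixed term of the stage, hence itself OFF — have total image law `≤ δ •` the pre-ℝ image laws of the OFF terms with the same
receiver, as soon as their printed quotients against the inserts `q s` and nesting constants `B s` have CHARGE `Σ q s · B s ≤ δ` (lens Card 57:
`(1+q̄)^{ν̄} − 1` by counting for the receiver-nested unit insert). [folklore] -/
theorem sum_map_postLaw_le (hins : ∀ s, Measurable (ins s)) (hd : ∀ s, Measurable (d s)) (hΦ : Measurable Φ) (hYO : Disjoint Y O)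
    (hYF : ∀ s, Disjoint Y (F s)) (hOF : ∀ s, Disjoint O (F s)) (hinsY : ∀ s, IndepOf Y (ins s)) (hdY : ∀ s, IndepOf Y (d s))
    (hΦ1 : ∫⋯∫⁻_Y, Φ ∂μ = fun _ => 1)
    (I On : Finset ι) (hsel : ∀ s ∈ I, sel s ∈ I) (hfix : ∀ s ∈ I, sel (sel s) = sel s) (hOn : ∀ s ∈ On, sel s ≠ s)
    {q B : ι → ℝ≥0∞} (hq : ∀ s ∈ I, s ∈ On → ∀ V, (∫⋯∫⁻_(O ∪ F s), d s ∂μ) V ≤ q s * (∫⋯∫⁻_(O ∪ F s), ins s ∂μ) V)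
    (hdom : ∀ s ∈ I, s ∈ On → ∀ V, ins s V ≤ B s * d (sel s) V)
    {u : (∀ i, X i) → ℝ} (hu : Measurable u) (huO : NotRead O u) (huY : NotRead Y u)
    {δ : ℝ≥0∞} (s' : ι) (hcharge : ∑ s ∈ I.filter (fun s => s ∈ On ∧ sel s = s'), q s * B s ≤ δ) :
    ∑ s ∈ I.filter (fun s => s ∈ On ∧ sel s = s'), (postLaw μ O F sel Φ ins d s).map u ≤
      δ • ∑ s ∈ I.filter (fun s => s ∉ On ∧ sel s = s'), (preLaw μ Φ d s).map u := by
  set A := I.filter (fun s => s ∈ On ∧ sel s = s') with hAdef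
  by_cases hA : A = ∅
  · rw [hA, Finset.sum_empty]; exact Measure.zero_le _
  obtain ⟨s₀, hs₀⟩ := Finset.nonempty_iff_ne_empty.2 hA
  have hs₀I : s₀ ∈ I := (Finset.mem_filter.1 hs₀).1
  have hs₀' : sel s₀ = s' := (Finset.mem_filter.1 hs₀).2.2
  -- the receiver is a stage term, `sel`-fixed, hence OFF
  have hs'I : s' ∈ I := hs₀' ▸ hsel s₀ hs₀I
  have hs'fix : sel s' = s' := by rw [← hs₀']; exact hfix s₀ hs₀I
  have hs'off : s' ∉ On := fun h => hOn s' h hs'fix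
  have hmem : s' ∈ I.filter (fun s => s ∉ On ∧ sel s = s') := Finset.mem_filter.2 ⟨hs'I, hs'off, hs'fix⟩
  -- each ON sender ≤ (q s · B s) • the receiver's pre-ℝ image law
  have h1 : ∑ s ∈ A, (postLaw μ O F sel Φ ins d s).map u ≤ ∑ s ∈ A, (q s * B s) • (preLaw μ Φ d s').map u := by
    refine Finset.sum_le_sum fun s hs => ?_
    obtain ⟨hsI, hsOn, hss'⟩ := Finset.mem_filter.1 hs
    rw [← hss']
    exact map_postLaw_le_of_sent hins hd hΦ hYO hYF hOF hinsY hdY hΦ1 (hOn s hsOn) (hq s hsI hsOn) (hdom s hsI hsOn) hu huO huY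
  refine h1.trans ?_
  rw [← Finset.sum_smul]
  calc (∑ s ∈ A, q s * B s) • (preLaw μ Φ d s').map u
      ≤ δ • (preLaw μ Φ d s').map u := by
        rw [Measure.le_iff]; intro B' hB'
        simp only [Measure.smul_apply, smul_eq_mul]
        exact mul_le_mul' hcharge le_rfl
    _ ≤ δ • ∑ s ∈ I.filter (fun s => s ∉ On ∧ sel s = s'), (preLaw μ Φ d s).map u := by
        rw [Measure.le_iff]; intro B' hB'
        simp only [Measure.smul_apply, smul_eq_mul]
        refine mul_le_mul' le_rfl ?_
        rw [Measure.finsetSum_apply]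
        exact Finset.single_le_sum (f := fun s => (preLaw μ Φ d s).map u B') (fun _ _ => bot_le) hmem

end OneStage

end Summit.QuantumFields.YangMills.Theorems.N21HistoriesLiftedStageLaws
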